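import Summits.BirchSwinnertonDyer.BirchSwinnertonDyer.Theorems.ManinLocalTwoThreeKummerDiamondStepTwoKummerClasses
import HarnessLib

/-!
# es's STEP 2 (D6 of LEAD's `kummer_diamond` line), IV: PROPOSITION A — the finish (`a ≥ 5`, `p ≡ 3 (mod 4)`, `h₂ = v ⊗ ψ_{−p}`, `h₁ : (ℤ/8)ˣ ⥲ im ϖ`)
(route `ManinLocalTwoThree`, crux C2 `ManinOddAtFour` stmt-BirchSwinnertonDyer-22967; cell bsd-f2-manin, prover p2 gen 21; es g38 PROOF-Ees185-186.md §4
PROPOSITION A «(Shape of S′) … forces Q₁ = 2^a with ⌈a/2⌉ ≥ 3, i.e. a ≥ 5 … ϖ_{p^b} = v·(·/p) … p ≡ 3 (mod 4) … (ℤ/8)ˣ ⥲ K»; `--supports stmt-BirchSwinnertonDyer-22967`)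

`propositionA_finish`: given the two active THEOREM-K classes `h₁ = f_{2^a}`, `h₂ = f_{p^b}` (`p` odd) with the same non-zero value `v` at complex
conjugation and `ϖ = h₁ + h₂` on values, derive `5 ≤ a`, `p % 4 = 3`, `h₂ σ = 0 ↔ IsSquare (χ σ : ZMod p)`, `h₂ ∈ {0, v}`, and the mod-`8` bijection law
for `h₁`.  UNCONDITIONAL abstract group theory (parts I–III); nothing about E-es-185, C2, Manin's conjecture or BSD is proved.  No definitions, no sorry.
[cite: Stevens1989, §2] [cite: Manin1972, Prop. 1.4 / Thm. 1.6]
-/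

set_option autoImplicit false
-- lint-debt: the directory name repeats the summit name (sibling precedent `ManinLocalTwoThreeKummerDiamondStepTwoTwoAdic.lean`)
set_option linter.dupNamespace false

open scoped MatrixGroups
open CongruenceSubgroup

namespace Summit.BirchSwinnertonDyer.BirchSwinnertonDyer.Theorems.ManinLocalTwoThree.StepTwo

variable {N : ℕ}

/-- **PROPOSITION A, the finish** (es STEP 2, second half).  Given the two active components `h₁ = f_{2^a}` and `h₂ = f_{p^b}` (`p` odd) of
THEOREM K with the same non-zero value `v` at complex conjugation `c` (`χ(c) = −1`) and `ϖ = ϖ_{2^a} + ϖ_{p^b}` on values: then `a ≥ 5`,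
`p ≡ 3 (mod 4)`, `h₂(σ) = 0 ↔ χ(σ)` is a square mod `p` (so `h₂ = v ⊗ ψ_{−p}`), and `h₁` is a BIJECTION from `χ(σ) mod 8` onto `im ϖ`. [folklore]
[cite: Stevens1989, §2] -/
theorem propositionA_finish [NeZero N] {V G : Type*} [AddCommGroup V] (w : Gamma0 N → V) (cyc : G → ℤ → Prop) (c : G)
    (hmul : ∀ γ γ' : Gamma0 N, w (γ * γ') = w γ + w γ')
    (hone : ∀ γ : Gamma0 N, ((((γ : SL(2, ℤ)) 1 1 : ℤ)) : ZMod N) = 1 → w γ = 0) (h2 : ∀ γ : Gamma0 N, w γ + w γ = 0)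
    (hM : ∀ γ : Gamma0 N, ((((γ : SL(2, ℤ)) 1 1 : ℤ)) : ZMod (Summit.BirchSwinnertonDyer.Rank1Residual.ManinAdditive.KummerDiamond.ceilSqrtLevel N)) = 1 ∨
      ((((γ : SL(2, ℤ)) 1 1 : ℤ)) : ZMod (Summit.BirchSwinnertonDyer.Rank1Residual.ManinAdditive.KummerDiamond.ceilSqrtLevel N)) = -1 → w γ = 0)
    (hK : 4 ≤ (Set.range w).ncard)
    (hcyc : ∀ σ : G, ∃ d d' : ℤ, ((d * d' : ℤ) : ZMod N) = 1 ∧ cyc σ d)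
    (hsup : ∀ d : ℤ, IsCoprime d (N : ℤ) → ∃ σ : G, cyc σ d) (hc : cyc c (-1))
    {a y₂ : ℕ} (hN₂ : 2 ^ a * y₂ = N) (hcop₂ : Nat.Coprime (2 ^ a) y₂) {h₁ : G → V}
    (hh₁ : ∀ (σ : G) (d d' : ℤ), ((d * d' : ℤ) : ZMod N) = 1 → cyc σ d → ∀ γ : Gamma0 N,
      ((((γ : SL(2, ℤ)) 1 1 : ℤ)) : ZMod (2 ^ a)) = (d' : ZMod (2 ^ a)) → ((((γ : SL(2, ℤ)) 1 1 : ℤ)) : ZMod (y₂)) = 1 → h₁ σ = w γ)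
    {p b yp : ℕ} (hp : p.Prime) (hp2 : p ≠ 2) (hb : 1 ≤ b) (hNp : p ^ b * yp = N) (hcopp : Nat.Coprime (p ^ b) yp) {h₂ : G → V}
    (hh₂ : ∀ (σ : G) (d d' : ℤ), ((d * d' : ℤ) : ZMod N) = 1 → cyc σ d → ∀ γ : Gamma0 N,
      ((((γ : SL(2, ℤ)) 1 1 : ℤ)) : ZMod (p ^ b)) = (d' : ZMod (p ^ b)) → ((((γ : SL(2, ℤ)) 1 1 : ℤ)) : ZMod (yp)) = 1 → h₂ σ = w γ)
    {v : V} (hv0 : v ≠ 0) (hh₁c : h₁ c = v) (hh₂c : h₂ c = v) (hsum : ∀ γ : Gamma0 N, ∃ σ : G, w γ = h₁ σ + h₂ σ) :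
    5 ≤ a ∧ p % 4 = 3 ∧
      (∀ (σ : G) (d d' : ℤ), ((d * d' : ℤ) : ZMod N) = 1 → cyc σ d → (h₂ σ = 0 ↔ IsSquare ((d : ZMod p)))) ∧
      (∀ (σ : G), h₂ σ = 0 ∨ h₂ σ = v) ∧
      (∀ (σ τ : G) (d d' e e' : ℤ), ((d * d' : ℤ) : ZMod N) = 1 → cyc σ d → ((e * e' : ℤ) : ZMod N) = 1 → cyc τ e →
        (h₁ σ = h₁ τ ↔ (d : ZMod 8) = (e : ZMod 8))) ∧
      (∀ γ : Gamma0 N, ∃ σ : G, h₁ σ = w γ) := by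
  haveI : Fact p.Prime := ⟨hp⟩
  have hpN : p ∣ N := dvd_trans (dvd_pow_self p (by omega)) ⟨yp, hNp.symm⟩
  have hppb : p ∣ p ^ b := dvd_pow_self p (by omega)
  have hy₂N : y₂ ∣ N := ⟨2 ^ a, by rw [← hN₂, mul_comm]⟩
  -- (a) base points
  obtain ⟨γc₂, hγc₂y, hγc₂⟩ := kum_apply w cyc hNp hcopp hcyc hh₂ c
  have hwc₂ : w γc₂ = v := by rw [← hγc₂, hh₂c]
  obtain ⟨γc₁, hγc₁y, hγc₁⟩ := kum_apply w cyc hN₂ hcop₂ hcyc hh₁ c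
  have hwc₁ : w γc₁ = v := by rw [← hγc₁, hh₁c]
  have hvv : v + v = 0 := by rw [← hwc₁]; exact h2 γc₁
  -- (b) `A_p ⊆ {0, v}`
  have hAp : ∀ γ : Gamma0 N, ((((γ : SL(2, ℤ)) 1 1 : ℤ)) : ZMod yp) = 1 → w γ = 0 ∨ w γ = v := by
    obtain ⟨v', hv'⟩ := exists_forall_eq_zero_or_eq_primePow w hmul hone h2 hp hp2 hNp hcopp
    have hv'v : v' = v := by
      rcases hv' γc₂ hγc₂y with h | h
      · exact absurd (hwc₂.symm.trans h) hv0
      · rw [← h, hwc₂]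
    rw [hv'v] at hv'; exact hv'
  have hh₂val : ∀ σ : G, h₂ σ = 0 ∨ h₂ σ = v := by
    intro σ
    obtain ⟨γ, hγy, hγ⟩ := kum_apply w cyc hNp hcopp hcyc hh₂ σ
    rw [hγ]; exact hAp γ hγy
  -- (d) `a ≥ 5`
  have ha5 : 5 ≤ a := by
    by_contra ha
    have hker := w_eq_zero_of_cast_ceil_eq_one w hN₂ hcop₂ hM
    obtain ⟨v'', hv''⟩ := exists_forall_eq_zero_or_eq_twoPow_le_two w hmul h2 (c := (a + 1) / 2) (by omega) (by omega)
      hN₂ hcop₂ hker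
    have hv''v : v'' = v := by
      rcases hv'' γc₁ hγc₁y with h | h
      · exact absurd (hwc₁.symm.trans h) hv0
      · rw [← h, hwc₁]
    rw [hv''v] at hv''
    have hall : ∀ γ : Gamma0 N, w γ = 0 ∨ w γ = v := by
      intro γ
      obtain ⟨σ, hσ⟩ := hsum γ
      obtain ⟨γ₁, hγ₁y, hγ₁⟩ := kum_apply w cyc hN₂ hcop₂ hcyc hh₁ σ
      rw [hσ, hγ₁]
      rcases hv'' γ₁ hγ₁y with h | h <;> rcases hh₂val σ with h' | h' <;> rw [h, h']
      · left; rw [add_zero]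
      · right; rw [zero_add]
      · right; rw [add_zero]
      · left; exact hvv
    have := ncard_range_le_two hall
    omega
  -- (e)/(f) the odd law for `h₂`
  have hodd := w_eq_zero_iff_isSquare w hmul hone h2 hp2 hb hNp hcopp ⟨γc₂, hγc₂y, by rw [hwc₂]; exact hv0⟩
  have hlaw₂ : ∀ (σ : G) (d d' : ℤ), ((d * d' : ℤ) : ZMod N) = 1 → cyc σ d → (h₂ σ = 0 ↔ IsSquare ((d : ZMod p))) := by
    intro σ d d' hdd' hσ
    obtain ⟨γ, hγQ, hγy⟩ := exists_gamma0_of_inv hNp hcopp hdd'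
    rw [hh₂ σ d d' hdd' hσ γ hγQ hγy, hodd γ hγy, cast_down hppb hγQ]
    have hdp : (d : ZMod p) * (d' : ZMod p) = 1 := by
      have h := cast_down_one hpN hdd'; push_cast at h; exact h
    rw [← inv_eq_of_mul_eq_one_right hdp, isSquare_inv]
  have hp3 : p % 4 = 3 := by
    have hdd : (((-1) * (-1) : ℤ) : ZMod N) = 1 := by push_cast; ring
    have h := (hlaw₂ c (-1) (-1) hdd hc).not.mp (by rw [hh₂c]; exact hv0)
    by_contra h3
    exact h (by push_cast; exact ZMod.exists_sq_eq_neg_one_iff.mpr h3)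
  -- (g) the law for `h₁`
  have ha3 : 3 ≤ a := by omega
  have h82a : 8 ∣ 2 ^ a := by rw [show 8 = 2 ^ 3 by norm_num]; exact pow_dvd_pow 2 ha3
  have h8N : 8 ∣ N := dvd_trans h82a ⟨y₂, hN₂.symm⟩
  have W8 := fun (γ γ' : Gamma0 N) ↦ w_eq_of_cast_eight_eq w hmul hone h2 ha3 hN₂ hcop₂ (γ := γ) (γ' := γ')
  have hA2all : ∀ γ : Gamma0 N, ∃ γ' : Gamma0 N, ((((γ' : SL(2, ℤ)) 1 1 : ℤ)) : ZMod y₂) = 1 ∧ w γ = w γ' := by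
    intro γ
    obtain ⟨σ, hσ⟩ := hsum γ
    obtain ⟨γ₁, hγ₁y, hγ₁⟩ := kum_apply w cyc hN₂ hcop₂ hcyc hh₁ σ
    rcases hh₂val σ with h | h
    · exact ⟨γ₁, hγ₁y, by rw [hσ, hγ₁, h, add_zero]⟩
    · refine ⟨γ₁ * γc₁, by rw [lowerRight_mul_cast _ _ hy₂N, hγ₁y, hγc₁y, one_mul], ?_⟩
      rw [hσ, hγ₁, h, hmul, hwc₁]
  -- odd representatives mod 8
  have hodd_d : ∀ γ : Gamma0 N, ¬ 2 ∣ ((γ : SL(2, ℤ)) 1 1 : ℤ) := fun γ ↦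
    not_two_dvd_of_isCoprime (isCoprime_lowerRight γ) (by
      rw [← hN₂]; push_cast; exact dvd_mul_of_dvd_left (dvd_pow_self 2 (by omega)) _)
  obtain ⟨γ₁, hγ₁r, hγ₁y⟩ := exists_gamma0_odd_rep hN₂ hcop₂ (r := 1) odd_one
  obtain ⟨γ₃, hγ₃r, hγ₃y⟩ := exists_gamma0_odd_rep hN₂ hcop₂ (r := 3) ⟨1, by norm_num⟩
  obtain ⟨γ₅, hγ₅r, hγ₅y⟩ := exists_gamma0_odd_rep hN₂ hcop₂ (r := 5) ⟨2, by norm_num⟩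
  obtain ⟨γ₇, hγ₇r, hγ₇y⟩ := exists_gamma0_odd_rep hN₂ hcop₂ (r := 7) ⟨3, by norm_num⟩
  have h₁8 : ((((γ₁ : SL(2, ℤ)) 1 1 : ℤ)) : ZMod 8) = 1 := by have h := cast_down h82a hγ₁r; push_cast at h; exact h
  have h₃8 : ((((γ₃ : SL(2, ℤ)) 1 1 : ℤ)) : ZMod 8) = 3 := by have h := cast_down h82a hγ₃r; push_cast at h; exact h
  have h₅8 : ((((γ₅ : SL(2, ℤ)) 1 1 : ℤ)) : ZMod 8) = 5 := by have h := cast_down h82a hγ₅r; push_cast at h; exact h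
  have h₇8 : ((((γ₇ : SL(2, ℤ)) 1 1 : ℤ)) : ZMod 8) = 7 := by have h := cast_down h82a hγ₇r; push_cast at h; exact h
  have hval : ∀ γ : Gamma0 N, ((((γ : SL(2, ℤ)) 1 1 : ℤ)) : ZMod y₂) = 1 →
      (((((γ : SL(2, ℤ)) 1 1 : ℤ)) : ZMod 8) = 1 ∧ w γ = w γ₁) ∨ (((((γ : SL(2, ℤ)) 1 1 : ℤ)) : ZMod 8) = 3 ∧ w γ = w γ₃) ∨
      (((((γ : SL(2, ℤ)) 1 1 : ℤ)) : ZMod 8) = 5 ∧ w γ = w γ₅) ∨ (((((γ : SL(2, ℤ)) 1 1 : ℤ)) : ZMod 8) = 7 ∧ w γ = w γ₇) := by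
    intro γ hγ
    rcases FreyTwistParity.cast_zmod_eight_of_not_two_dvd (hodd_d γ) with h | h | h | h
    · exact Or.inl ⟨h, W8 γ γ₁ hγ hγ₁y (by rw [h, h₁8])⟩
    · exact Or.inr (Or.inl ⟨h, W8 γ γ₃ hγ hγ₃y (by rw [h, h₃8])⟩)
    · exact Or.inr (Or.inr (Or.inl ⟨h, W8 γ γ₅ hγ hγ₅y (by rw [h, h₅8])⟩))
    · exact Or.inr (Or.inr (Or.inr ⟨h, W8 γ γ₇ hγ hγ₇y (by rw [h, h₇8])⟩))
  have hsub : Set.range w ⊆ ({w γ₁, w γ₃, w γ₅, w γ₇} : Set V) := by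
    rintro _ ⟨γ, rfl⟩
    obtain ⟨γ', hγ'y, hγγ'⟩ := hA2all γ
    rw [hγγ']
    rcases hval γ' hγ'y with ⟨-, h⟩ | ⟨-, h⟩ | ⟨-, h⟩ | ⟨-, h⟩ <;> simp [h]
  have h4 : 4 ≤ ({w γ₁, w γ₃, w γ₅, w γ₇} : Set V).ncard := hK.trans (Set.ncard_le_ncard hsub (Set.toFinite _))
  obtain ⟨n13, n15, n17, n35, n37, n57⟩ := pairwise_ne_of_ncard_four h4
  have n31 := n13.symm; have n51 := n15.symm; have n71 := n17.symm
  have n53 := n35.symm; have n73 := n37.symm; have n75 := n57.symm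
  have hinj : ∀ γ γ' : Gamma0 N, ((((γ : SL(2, ℤ)) 1 1 : ℤ)) : ZMod y₂) = 1 → ((((γ' : SL(2, ℤ)) 1 1 : ℤ)) : ZMod y₂) = 1 →
      w γ = w γ' → ((((γ : SL(2, ℤ)) 1 1 : ℤ)) : ZMod 8) = ((((γ' : SL(2, ℤ)) 1 1 : ℤ)) : ZMod 8) := by
    intro γ γ' hγ hγ' hw
    rcases hval γ hγ with ⟨hr, hwr⟩ | ⟨hr, hwr⟩ | ⟨hr, hwr⟩ | ⟨hr, hwr⟩ <;>
      rcases hval γ' hγ' with ⟨hs, hws⟩ | ⟨hs, hws⟩ | ⟨hs, hws⟩ | ⟨hs, hws⟩ <;>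
      rw [hr, hs] <;>
      first | rfl | exact absurd (hwr.symm.trans (hw.trans hws)) (by assumption)
  refine ⟨ha5, hp3, hlaw₂, hh₂val, ?_, ?_⟩
  · intro σ τ d d' e e' hdd' hσ hee' hτ
    obtain ⟨γσ, hγσQ, hγσy⟩ := exists_gamma0_of_inv hN₂ hcop₂ hdd'
    obtain ⟨γτ, hγτQ, hγτy⟩ := exists_gamma0_of_inv hN₂ hcop₂ hee'
    rw [hh₁ σ d d' hdd' hσ γσ hγσQ hγσy, hh₁ τ e e' hee' hτ γτ hγτQ hγτy]
    have hdσ : ((((γσ : SL(2, ℤ)) 1 1 : ℤ)) : ZMod 8) = (d : ZMod 8) := by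
      rw [cast_down h82a hγσQ]
      refine (zmod_eight_eq_of_mul_eq_one _ _ ?_).symm
      have h := cast_down_one h8N hdd'; push_cast at h; exact h
    have heτ : ((((γτ : SL(2, ℤ)) 1 1 : ℤ)) : ZMod 8) = (e : ZMod 8) := by
      rw [cast_down h82a hγτQ]
      refine (zmod_eight_eq_of_mul_eq_one _ _ ?_).symm
      have h := cast_down_one h8N hee'; push_cast at h; exact h
    rw [← hdσ, ← heτ]
    exact ⟨hinj γσ γτ hγσy hγτy, W8 γσ γτ hγσy hγτy⟩
  · intro γ
    obtain ⟨γ', hγ'y, hγγ'⟩ := hA2all γ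
    obtain ⟨σ, hσ⟩ := kum_surj w cyc hsup hh₁ γ' hγ'y
    exact ⟨σ, by rw [hσ, hγγ']⟩

end Summit.BirchSwinnertonDyer.BirchSwinnertonDyer.Theorems.ManinLocalTwoThree.StepTwo
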